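import Literature.Topology.PlanarFoliations.PatternCycles
import Literature.Topology.PlanarFoliations.Kneser
import HarnessLib

/-!
# The count of a pattern cycle: separatrix leaves and punctures in its fill

Topic: Topology / PlanarFoliations, sequel to `PatternCycles.lean`, `Kneser.lean` (the disc of a
compact leaf), `Punctures.lean` (level leaves). The minimiser scheme of the graph case of the
vanishing-cycle theorem minimises, over the essential pattern cycles (compact leaves and simple
separatrix polygons), the **count** `λ(A)` of a closed plane set `A` (the fill of the pattern):
the number of **separatrix leaves** with image in `A` plus the number of **punctures** in `A`.
Here the separatrix leaves available for counting are the leaves of the finitely many base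
points of the level leaves of the punctures (`sepLeaves`, finite: `finite_sepLeaves`), among which
are the leaves of every polygon (`PolyCycle.leaf_mem_sepLeaves`,
`PunctureData.exists_mem_levelLeaves_of_omegaSet_subset`). We prove: the count is monotone
(`count_mono`); the leaves of a polygon lie on its curve (`PolyCycle.image_leaf_subset_range`),
so a polygon's fill has count `≥ 1` (indeed `≥` its number of punctures); the disc of a compact
leaf inside the region has count `≥ 1` (it contains a puncture, by Kneser's theorem
`not_discLeaf_subset_range`).

## References

* C. Camacho, A. Lins Neto, *Geometric Theory of Foliations*, Birkhäuser (1985), Ch. VII §2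
  [CamachoLinsNeto1985].
-/

noncomputable section

open Set Filter Function Metric unitInterval
open _root_.Topology
open Literature.Topology.FourManifolds Literature.Topology.FourManifolds.Foliation Literature.Topology.PlaneTopology

namespace Literature.Topology.PlanarFoliations

variable {X : Type*} [TopologicalSpace X] [T2Space X] [SecondCountableTopology X] [Nonempty X] {F : Foliation ℝ X} {ι : X → ℂ}
variable {B : Type*} [NormedAddCommGroup B] {M : Type*} [TopologicalSpace M] {T : Foliation B M} {g : ℂ → M}

namespace StarData

variable (D : StarData F ι T g)

/-! ## The separatrix leaves available for counting -/

/-- The base points of the level leaves of all punctures. [folklore] -/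
def levelBase : Set X := ⋃ v ∈ D.P, D.levelLeaves v

omit [T2Space X] [SecondCountableTopology X] [Nonempty X] in
/-- There are finitely many base points of level leaves. [folklore] -/
theorem finite_levelBase : D.levelBase.Finite := D.P_finite.biUnion fun v _ ↦ D.finite_levelLeaves v

/-- **The separatrix leaves available for counting**: the leaves of the base points of the level
leaves. [folklore] -/
def sepLeaves : Set (Set X) := (fun s ↦ F.leaf s) '' D.levelBase

omit [T2Space X] [SecondCountableTopology X] [Nonempty X] in
/-- **There are finitely many separatrix leaves.** [folklore] -/
theorem finite_sepLeaves : D.sepLeaves.Finite := D.finite_levelBase.image _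

omit [T2Space X] [SecondCountableTopology X] [Nonempty X] in
/-- A leaf through a level leaf of a puncture is a separatrix leaf for counting. [folklore] -/
theorem leaf_mem_sepLeaves {v : ℂ} (hv : v ∈ D.P) {s x : X} (hs : s ∈ D.levelLeaves v) (hx : x ∈ F.leaf s) :
    F.leaf x ∈ D.sepLeaves :=
  ⟨s, mem_biUnion hv hs, (leaf_eq_of_mem hx).symm⟩

/-! ## The count -/

/-- **The count of a plane set**: separatrix leaves with image in it plus punctures in it.
[folklore] -/
def count (A : Set ℂ) : ℕ := {L ∈ D.sepLeaves | ι '' L ⊆ A}.ncard + (D.P ∩ A).ncard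

omit [T2Space X] [SecondCountableTopology X] [Nonempty X] in
/-- The counted leaves are finitely many. [folklore] -/
theorem finite_counted (A : Set ℂ) : {L ∈ D.sepLeaves | ι '' L ⊆ A}.Finite := D.finite_sepLeaves.subset (sep_subset _ _)

omit [T2Space X] [SecondCountableTopology X] [Nonempty X] in
/-- **The count is monotone.** [folklore] -/
theorem count_mono {A A' : Set ℂ} (h : A ⊆ A') : D.count A ≤ D.count A' :=
  add_le_add (ncard_le_ncard (fun _ hL ↦ ⟨hL.1, hL.2.trans h⟩) (D.finite_counted A'))
    (ncard_le_ncard (inter_subset_inter_right _ h) (D.P_finite.subset inter_subset_left))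

omit [T2Space X] [SecondCountableTopology X] [Nonempty X] in
/-- A set containing a puncture has positive count. [folklore] -/
theorem one_le_count_of_mem {A : Set ℂ} {v : ℂ} (hv : v ∈ D.P) (hvA : v ∈ A) : 1 ≤ D.count A := by
  have h : 1 ≤ (D.P ∩ A).ncard := by
    rw [Nat.one_le_iff_ne_zero, Ne, ncard_eq_zero (D.P_finite.subset inter_subset_left)]
    exact fun he ↦ (eq_empty_iff_forall_notMem.1 he) v ⟨hv, hvA⟩
  exact le_add_left h

/-! ## The count of a compact leaf's disc -/

omit [Nonempty X] in
/-- **The disc of a compact leaf inside the region contains a puncture** (Kneser). [folklore] -/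
theorem exists_mem_P_mem_discLeaf (hbi : IsBiOriented F) (hι : IsOpenEmbedding ι) {y : X} (hK : IsCompact (F.leaf y))
    (hdisc : discLeaf F ι y ⊆ D.Ω) : ∃ v ∈ D.P, v ∈ discLeaf F ι y := by
  by_contra h
  push Not at h
  refine not_discLeaf_subset_range hbi hι hK fun z hz ↦ ?_
  rw [D.range_eq]
  exact ⟨hdisc hz, fun hzP ↦ h z hzP hz⟩

omit [Nonempty X] in
/-- **The disc of a compact leaf inside the region has positive count.** [folklore] -/
theorem one_le_count_discLeaf (hbi : IsBiOriented F) (hι : IsOpenEmbedding ι) {y : X} (hK : IsCompact (F.leaf y))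
    (hdisc : discLeaf F ι y ⊆ D.Ω) : 1 ≤ D.count (discLeaf F ι y) := by
  obtain ⟨v, hv, hvd⟩ := D.exists_mem_P_mem_discLeaf hbi hι hK hdisc
  exact D.one_le_count_of_mem hv hvd

/-! ## The count of a polygon's fill -/

namespace PolyCycle

variable {D} {hbi : IsBiOriented F} {C : Set ℂ} (Z : D.PolyCycle hbi C) (hι : IsOpenEmbedding ι) (hC : IsCompact C)

omit [Nonempty X] in
include hC in
/-- **The leaves of a polygon are separatrix leaves for counting.** [folklore] -/
theorem leaf_mem_sepLeaves (i : Fin Z.m) : F.leaf (Z.sx i) ∈ D.sepLeaves := by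
  obtain ⟨s, hs, hxs⟩ := D.exists_mem_levelLeaves_of_omegaSet_subset (hbi := hbi) (Z.hv i) hC (Z.hmem i) (by rw [Z.omega i])
  exact D.leaf_mem_sepLeaves (Z.hv i) hs hxs

/-- **Every point of a leaf of the polygon is on its piece**: before the start of the link it is
on the outgoing prong arc, between the ends of the link on the link, after the end on the incoming
prong arc. [folklore] -/
theorem exists_piece_eq (i : Fin Z.m) (q : F.Leaf (Z.sx (i + 1))) :
    ∃ θ : I, D.piece hι hC Z.hv Z.hmem Z.omega Z.alpha i θ = ι (Leaf.pt q) := by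
  have hαi : Z.vtx i ∈ alphaSet hbi ι (Z.sx (i + 1)) := by rw [Z.alpha i]; exact mem_singleton _
  have hωi : Z.vtx (i + 1) ∈ omegaSet hbi ι (Z.sx (i + 1)) := by rw [Z.omega (i + 1)]; exact mem_singleton _
  set E := D.jc hι hC Z.hv Z.hmem Z.omega Z.alpha i with hE
  set E' := D.jc hι hC Z.hv Z.hmem Z.omega Z.alpha (i + 1) with hE'
  set a := D.linkStart hι hC Z.hv Z.hmem Z.omega Z.alpha i with ha
  set a' := D.linkEnd hι hC Z.hv Z.hmem Z.omega Z.alpha i with ha'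
  have haS := D.linkStart_spec hι hC Z.hv Z.hmem Z.omega Z.alpha i
  have haS' := D.linkEnd_spec hι hC Z.hv Z.hmem Z.omega Z.alpha i
  -- the range of the piece contains the three arcs
  have hsub : ∀ z, (z ∈ range (D.outArc hι hC Z.hv Z.hmem Z.omega Z.alpha i) ∨ z ∈ range (D.linkArc hι hC Z.hv Z.hmem Z.omega Z.alpha i) ∨
      z ∈ range (D.inArc hι hC Z.hv Z.hmem Z.omega Z.alpha i)) → z ∈ range (D.piece hι hC Z.hv Z.hmem Z.omega Z.alpha i) := by
    intro z hz
    rw [piece, range_transFun_eq, range_transFun_eq]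
    · simp only [mem_union]; tauto
    · exact D.outArc_one hι hC Z.hv Z.hmem Z.omega Z.alpha i
    · rw [transFun_one]; exact (D.inArc_zero hι hC Z.hv Z.hmem Z.omega Z.alpha i).symm
  -- position of `q` relative to the ends of the link
  by_cases h1 : leafLT hbi q a
  · -- before the start: on the outgoing arc (the backward tail)
    have hqb : q ∈ bwd hbi E.Eb.p := ProngStar.BwdTail.bwd_mono haS.1 (show ¬ leafLT hbi a q from leafLT_asymm h1)
    obtain ⟨β, hβ, hιq, -, hbq⟩ := E.Eb.mem_S_of_mem_bwd hqb
    -- its parameter is at most `β_i`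
    have hle : β ≤ E.β := by
      have := (E.Eb.leafLT_iff_b_lt hι hαi haS.1 hqb).1 h1
      rw [hbq, D.b_linkStart hι hC Z.hv Z.hmem Z.omega Z.alpha i] at this
      exact this.le
    set u : I := ⟨β / E.β, div_nonneg hβ.1.le E.hβout.1.le, (div_le_one E.hβout.1).2 hle⟩ with hu
    obtain ⟨θ, hθ⟩ := hsub _ (Or.inl ⟨u, rfl⟩)
    refine ⟨θ, ?_⟩
    rw [hθ, hιq, outArc]
    congr 2
    show β / E.β * E.β = β
    exact div_mul_cancel₀ β E.hβout.1.ne'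
  by_cases h2 : leafLT hbi a' q
  · -- after the end: on the incoming arc (the forward tail)
    have hqf : q ∈ fwd hbi E'.Ef.p := fwd_mono haS'.1 (show ¬ leafLT hbi q a' from leafLT_asymm h2)
    obtain ⟨β, hβ, hιq, -, hbq⟩ := E'.Ef.mem_S_of_mem_fwd hqf
    have hle : β ≤ E'.β := by
      have := (E'.Ef.leafLT_iff_b_lt hι hωi haS'.1 hqf).1 h2
      rw [hbq, D.b_linkEnd hι hC Z.hv Z.hmem Z.omega Z.alpha i] at this
      exact this.le
    set u : I := ⟨1 - β / E'.β, by constructor <;> [linarith [(div_le_one E'.hβin.1).2 hle]; linarith [div_nonneg hβ.1.le E'.hβin.1.le]]⟩ with hu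
    obtain ⟨θ, hθ⟩ := hsub _ (Or.inr (Or.inr ⟨u, rfl⟩))
    refine ⟨θ, ?_⟩
    rw [hθ, hιq, inArc]
    congr 2
    show (1 - (1 - β / E'.β)) * E'.β = β
    rw [sub_sub_cancel]
    exact div_mul_cancel₀ β E'.hβin.1.ne'
  · -- in between: on the link
    have hq : q ∈ leafIcc hbi a a' := ⟨h1, h2⟩
    obtain ⟨u, hu⟩ := (D.mem_range_cycℓ_iff hι hC Z.hv Z.hmem Z.omega Z.alpha i).2 ⟨q, hq, rfl⟩
    obtain ⟨θ, hθ⟩ := hsub _ (Or.inr (Or.inl ⟨u, rfl⟩))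
    exact ⟨θ, by rw [hθ, linkArc, hu]⟩

/-- **The leaves of the polygon lie on its curve.** [folklore] -/
theorem image_leaf_subset_range (i : Fin Z.m) : ι '' F.leaf (Z.sx i) ⊆ range (Z.loop hι hC) := by
  -- write `i = (i - 1) + 1`
  have hi : i = (i - 1) + 1 := (sub_add_cancel i 1).symm
  rintro _ ⟨y, hy, rfl⟩
  rw [hi] at hy
  obtain ⟨θ, hθ⟩ := Z.exists_piece_eq hι hC (i - 1) (Leaf.mk y hy)
  have : D.piece hι hC Z.hv Z.hmem Z.omega Z.alpha (i - 1) θ = ι y := hθ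
  rw [← this]
  exact D.range_piece_subset_range_polyLoop hι hC Z.hv Z.hmem Z.omega Z.alpha (i - 1) ⟨θ, rfl⟩

/-- The leaves of the polygon have image in its fill. [folklore] -/
theorem image_leaf_subset_fill (i : Fin Z.m) : ι '' F.leaf (Z.sx i) ⊆ Z.fill hι hC :=
  (Z.image_leaf_subset_range hι hC i).trans (Z.range_subset_fill hι hC)

omit [Nonempty X] in
/-- Distinct indices give distinct counted leaves. [folklore] -/
theorem injective_leaf : Injective fun i : Fin Z.m ↦ F.leaf (Z.sx i) := fun a b h ↦ Z.hsx a b h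

/-- **The count of a polygon's fill is at least its number of separatrices plus one** (its leaves
and the puncture `vtx 0` are counted). [folklore] -/
theorem card_add_one_le_count : Z.m + 1 ≤ D.count (Z.fill hι hC) := by
  have h1 : Z.m ≤ {L ∈ D.sepLeaves | ι '' L ⊆ Z.fill hι hC}.ncard := by
    have hsub : range (fun i : Fin Z.m ↦ F.leaf (Z.sx i)) ⊆ {L ∈ D.sepLeaves | ι '' L ⊆ Z.fill hι hC} := by
      rintro _ ⟨i, rfl⟩
      exact ⟨Z.leaf_mem_sepLeaves hC i, Z.image_leaf_subset_fill hι hC i⟩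
    calc Z.m = (range fun i : Fin Z.m ↦ F.leaf (Z.sx i)).ncard := by
          rw [← image_univ, ncard_image_of_injective _ Z.injective_leaf, ncard_univ, Nat.card_eq_fintype_card, Fintype.card_fin]
      _ ≤ _ := ncard_le_ncard hsub (D.finite_counted _)
  have h2 : 1 ≤ (D.P ∩ Z.fill hι hC).ncard := by
    rw [Nat.one_le_iff_ne_zero, Ne, ncard_eq_zero (D.P_finite.subset inter_subset_left)]
    exact fun he ↦ (eq_empty_iff_forall_notMem.1 he) (Z.vtx 0) ⟨Z.hv 0, Z.vtx_mem_fill hι hC 0⟩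
  exact add_le_add h1 h2

/-- The count of a polygon's fill is positive. [folklore] -/
theorem one_le_count : 1 ≤ D.count (Z.fill hι hC) :=
  le_trans (by omega) (Z.card_add_one_le_count hι hC)

end PolyCycle

end StarData

end Literature.Topology.PlanarFoliations
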